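import Summits.QuantumFields.QCD.Theses.QuarksAsStableAction
import Literature.MathematicalPhysics.QuantumLattice.WilsonDiracAP
import Literature.MathematicalPhysics.QuantumLattice.WilsonFermionBlockAveraging
import Summits.QuantumFields.QCD.Theorems.QuarksAsStableActionWilsonQuarkStabilityStubFreeTwistedFourier
import Summits.QuantumFields.QCD.Theorems.QuarksAsStableActionWilsonQuarkStabilityStubAPLatticeSum
import Summits.QuantumFields.QCD.Theorems.QuarksAsStableActionCriticalLineDiamagnetismStubFreeDetFormula

/-!
# A volume-uniform entry bound for the free antiperiodic Wilson propagator
(helper for crux stmt-QuantumFields-9737, line `Sketch`, card `sylvester-defect-floor` — ideator 2's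
`FreeDiagonalPropagatorBound`; registered stubs `free_ap_propagator_entry_bound` and its corollary
`free_diagonal_propagator_bound` of the lead's skeleton `work/StableActionBridge.lean`)

For the FREE `r = 1` Wilson–Dirac operator on the four-torus `(ℤ/L)⁴` (colour `Fin 3`, spin `Fin 4`,
bare mass `m ∈ [-1/2, 1]`) with fermionic boundary conditions ANTIPERIODIC in all four directions —
the trivial `U(3)` field sign-flipped on the links `e` with `e.1 e.2 = -1` (those leaving the slice
`x_μ = L - 1` in their own direction) — EVERY entry of the propagator `D⁻¹` is bounded by an absolute
constant (`C = 153`), uniformly in the volume `L ≥ 1`, the mass and the pair of indices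
("4D integrability of the massless lattice propagator").

Proof.  (1) SEAM ↔ PHASE (`FreeDetFormula.gaugeTransform_phase_eq_seam` of the sibling crux
`CriticalLineDiamagnetism`, seam condition `val x_μ + 1 = L ↔ x_μ = -1`, `seam_eq_gaugeTransform_phase`):
the seam field is the gauge transform of the CONSTANT field `ω = e^{iπ/L}·1` by
`s x := ω ^ (Σ_ν val x_ν)`, so by gauge covariance of the operator (`wilsonDirac_gaugeTransform`)
`D_AP = 𝒢 D_ω 𝒢⁻¹` and `D_AP⁻¹ = 𝒢 D_ω⁻¹ 𝒢⁻¹`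
(`inv_gaugeRotation_conj`); conjugating by the unitary block-diagonal gauge rotations costs at most a
factor `3 · 3 = 9` on the sup of the entries (`norm_gaugeRotation_conj_le`; entries of a unitary matrix
are `≤ 1`).  (2) FOURIER (`stub_freeTwistedFourier` at `θ₀ = π/L`):
`D_ω⁻¹((x,a,α),(y,b,β)) = δ_{ab} L⁻⁴ Σ_k χ_k(x) conj χ_k(y) (M(k)ᴴ)_{αβ} / h(k)` with the colour–spin
symbol `M(k) = (m + Σ_μ(1 − cos φ_μ))·1 + iΣ_μ sin φ_μ γ_μ`, `h(k) = (m + Σ_μ(1 − cos φ_μ))² + Σ_μ sin² φ_μ`,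
`φ_μ = (2k_μ + 1)π/L`.  (3) The Clifford identity `M(k)ᴴ M(k) = h(k)·1`
(`clifford_conjTranspose_mul_self`) gives `|(M(k)ᴴ)_{αβ}|² ≤ h(k)`, hence
`|(M(k)ᴴ)_{αβ}| / h(k) ≤ 1 + 1/h(k)` and `|D_ω⁻¹(p,q)| ≤ 1 + L⁻⁴ Σ_k 1/h(k)` (`norm_fourier_entry_le`).
(4) LATTICE SUM: for `|m| ≤ 1/2`, `h > 0` and `L⁻⁴ Σ_k 1/h(k) ≤ 16` (`stub_apLatticeSum`); for
`m > 1/2`, `h(k) ≥ m² > 1/4` directly (so the upper constraint `m ≤ 1` of the registered signature is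
not used); hence `|D_ω⁻¹(p,q)| ≤ 17` (`norm_inv_phase_apply_le`) and `|D_AP⁻¹(p,q)| ≤ 9 · 17 = 153`.

References: Montvay–Münster, *Quantum Fields on a Lattice* §4.2.4 (free antiperiodic Wilson fermions in
momentum space) [cite: MontvayMunster1994, §4.2.4]; the gauge-covariance and Clifford steps are folklore.
Pure theorem file (no definitions).
-/

noncomputable section

open scoped BigOperators Matrix ComplexConjugate
open Complex (I)
open Literature.MathematicalPhysics.QuantumLattice Literature.MathematicalPhysics.QuantumFieldTheory
  Literature.Probability.LatticeModels
open Summit.QuantumFields.QCD.Cruxes.TipNoBinding.PositivityNoLeakSpread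
  (clifford_conjTranspose_mul_self card_torusSite_four)
open Summit.QuantumFields.QCD.Cruxes.WilsonQuarkStability.FreeTangentLandauChessboard
  (stub_freeTwistedFourier stub_apLatticeSum)
open Summit.QuantumFields.QCD.Cruxes.CriticalLineDiamagnetism.ChessboardCellGain.FreeDetFormula
  (phase_mem_unitaryGroup val_add_one_eq_iff gaugeTransform_phase_eq_seam)

namespace Summit.QuantumFields.QCD.Cruxes.StableActionBridge.Sketch

namespace FreePropagatorBound

variable {L : ℕ} [NeZero L]

/-! ### Seam ↔ phase -/

/-- **The antiperiodic seam field is a gauge transform of the constant phase field** `ω = e^{iπ/L}·1`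
(by `s x := ω ^ (Σ_ν val x_ν)`): the tree's `FreeDetFormula.gaugeTransform_phase_eq_seam` with its seam
condition `val x_μ + 1 = L` rewritten as `x_μ = -1` (`FreeDetFormula.val_add_one_eq_iff`). -/
theorem seam_eq_gaugeTransform_phase {ω : Matrix.unitaryGroup (Fin 3) ℂ}
    (hω : (ω : Matrix (Fin 3) (Fin 3) ℂ) =
      Complex.exp (↑(Real.pi / L) * I) • (1 : Matrix (Fin 3) (Fin 3) ℂ)) :
    (fun e : Edge 4 L => if e.1 e.2 = -1 then (-1 : Matrix.unitaryGroup (Fin 3) ℂ) else 1) =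
      gaugeTransform (fun x : Site 4 L => ω ^ (∑ ν, (x ν).val)) (fun _ : Edge 4 L => ω) := by
  rw [gaugeTransform_phase_eq_seam hω]
  funext e
  exact if_congr (val_add_one_eq_iff (e.1 e.2)).symm rfl rfl

/-! ### Gauge conjugation of the propagator -/

/-- `(𝒢 D 𝒢⁻¹)⁻¹ = 𝒢 D⁻¹ 𝒢⁻¹` for the gauge rotation `𝒢 = 𝒢(g)` of any lattice gauge transformation
`g` (`𝒢(g) 𝒢(g⁻¹) = 𝒢(g⁻¹) 𝒢(g) = 1`; no invertibility of `D` needed, `Matrix.mul_inv_rev`). -/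
theorem inv_gaugeRotation_conj (g : TorusSite 4 L → Matrix.unitaryGroup (Fin 3) ℂ)
    (D : Matrix (TorusSite 4 L × Fin 3 × Fin 4) (TorusSite 4 L × Fin 3 × Fin 4) ℂ) :
    (gaugeRotation (unitaryFundamentalRep (Fin 3) ℂ) (Fin 4) g * D *
        gaugeRotation (unitaryFundamentalRep (Fin 3) ℂ) (Fin 4) g⁻¹)⁻¹ =
      gaugeRotation (unitaryFundamentalRep (Fin 3) ℂ) (Fin 4) g * D⁻¹ *
        gaugeRotation (unitaryFundamentalRep (Fin 3) ℂ) (Fin 4) g⁻¹ := by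
  rw [Matrix.mul_inv_rev, Matrix.mul_inv_rev,
    Matrix.inv_eq_right_inv (gaugeRotation_inv_mul (σ := Fin 4) (unitaryFundamentalRep (Fin 3) ℂ) g),
    Matrix.inv_eq_right_inv (gaugeRotation_mul_inv (σ := Fin 4) (unitaryFundamentalRep (Fin 3) ℂ) g),
    Matrix.mul_assoc]

/-- Left multiplication by a unitary gauge rotation at most triples the sup of the entries
(each entry of a unitary `3 × 3` matrix has modulus `≤ 1`). -/
theorem norm_gaugeRotation_mul_le (g : TorusSite 4 L → Matrix.unitaryGroup (Fin 3) ℂ)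
    {Y : Type*} (A : Matrix (TorusSite 4 L × Fin 3 × Fin 4) Y ℂ) {C : ℝ}
    (hA : ∀ p q, ‖A p q‖ ≤ C) (p : TorusSite 4 L × Fin 3 × Fin 4) (q : Y) :
    ‖(gaugeRotation (unitaryFundamentalRep (Fin 3) ℂ) (Fin 4) g * A) p q‖ ≤ 3 * C := by
  rw [gaugeRotation_mul_apply]
  calc ‖∑ b, unitaryFundamentalRep (Fin 3) ℂ (g p.1) p.2.1 b * A (p.1, b, p.2.2) q‖
      ≤ ∑ b, ‖unitaryFundamentalRep (Fin 3) ℂ (g p.1) p.2.1 b * A (p.1, b, p.2.2) q‖ :=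
        norm_sum_le _ _
    _ ≤ ∑ _b : Fin 3, C := Finset.sum_le_sum fun b _ => by
        rw [norm_mul]
        calc ‖unitaryFundamentalRep (Fin 3) ℂ (g p.1) p.2.1 b‖ * ‖A (p.1, b, p.2.2) q‖
            ≤ 1 * ‖A (p.1, b, p.2.2) q‖ :=
              mul_le_mul_of_nonneg_right (entry_norm_bound_of_unitary (g p.1).prop _ _)
                (norm_nonneg _)
          _ ≤ C := by rw [one_mul]; exact hA _ _
    _ = 3 * C := by simp

/-- Right multiplication by a unitary gauge rotation at most triples the sup of the entries. -/
theorem norm_mul_gaugeRotation_le (g : TorusSite 4 L → Matrix.unitaryGroup (Fin 3) ℂ)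
    {Y : Type*} (A : Matrix Y (TorusSite 4 L × Fin 3 × Fin 4) ℂ) {C : ℝ}
    (hA : ∀ p q, ‖A p q‖ ≤ C) (p : Y) (q : TorusSite 4 L × Fin 3 × Fin 4) :
    ‖(A * gaugeRotation (unitaryFundamentalRep (Fin 3) ℂ) (Fin 4) g) p q‖ ≤ 3 * C := by
  rw [mul_gaugeRotation_apply]
  calc ‖∑ a, A p (q.1, a, q.2.2) * unitaryFundamentalRep (Fin 3) ℂ (g q.1) a q.2.1‖
      ≤ ∑ a, ‖A p (q.1, a, q.2.2) * unitaryFundamentalRep (Fin 3) ℂ (g q.1) a q.2.1‖ :=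
        norm_sum_le _ _
    _ ≤ ∑ _a : Fin 3, C := Finset.sum_le_sum fun a _ => by
        rw [norm_mul]
        calc ‖A p (q.1, a, q.2.2)‖ * ‖unitaryFundamentalRep (Fin 3) ℂ (g q.1) a q.2.1‖
            ≤ ‖A p (q.1, a, q.2.2)‖ * 1 :=
              mul_le_mul_of_nonneg_left (entry_norm_bound_of_unitary (g q.1).prop _ _)
                (norm_nonneg _)
          _ ≤ C := by rw [mul_one]; exact hA _ _
    _ = 3 * C := by simp

/-- Conjugation by unitary gauge rotations, `A ↦ 𝒢(g) A 𝒢(g)⁻¹`, multiplies the sup of the entries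
by at most `9`. -/
theorem norm_gaugeRotation_conj_le (g : TorusSite 4 L → Matrix.unitaryGroup (Fin 3) ℂ)
    (A : Matrix (TorusSite 4 L × Fin 3 × Fin 4) (TorusSite 4 L × Fin 3 × Fin 4) ℂ) {C : ℝ}
    (hA : ∀ p q, ‖A p q‖ ≤ C) (p q : TorusSite 4 L × Fin 3 × Fin 4) :
    ‖(gaugeRotation (unitaryFundamentalRep (Fin 3) ℂ) (Fin 4) g * A *
        gaugeRotation (unitaryFundamentalRep (Fin 3) ℂ) (Fin 4) g⁻¹) p q‖ ≤ 9 * C := by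
  have h := norm_mul_gaugeRotation_le g⁻¹ _ (norm_gaugeRotation_mul_le g A hA) p q
  linarith

/-! ### Entry bound of the Fourier representation -/

/-- From `Nᴴ N = h·1`: `‖(Nᴴ)_{αβ}‖² ≤ h` (the `(α, α)` entry of `Nᴴ N` is `Σ_l ‖N_{lα}‖² = h`, and
`(Nᴴ)_{αβ} = conj N_{βα}` is the conjugate of one of the summands). -/
theorem norm_sq_conjTranspose_apply_le (N : Matrix (Fin 4) (Fin 4) ℂ) (h : ℝ)
    (hN : Nᴴ * N = ((h : ℝ) : ℂ) • (1 : Matrix (Fin 4) (Fin 4) ℂ)) (α β : Fin 4) :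
    ‖Nᴴ α β‖ ^ 2 ≤ h := by
  have h1 : (Nᴴ * N) α α = (h : ℂ) := by
    rw [hN, Matrix.smul_apply, Matrix.one_apply_eq, smul_eq_mul, mul_one]
  rw [Matrix.mul_apply] at h1
  simp only [Matrix.conjTranspose_apply, Complex.star_def, Complex.conj_mul'] at h1
  have h2 : ∑ l, ‖N l α‖ ^ 2 = h := by exact_mod_cast h1
  rw [Matrix.conjTranspose_apply, Complex.star_def, Complex.norm_conj, ← h2]
  exact Finset.single_le_sum (f := fun l => ‖N l α‖ ^ 2) (fun l _ => sq_nonneg _) (Finset.mem_univ β)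

/-- **Entry bound of the plane-wave representation.**  If `M(k)ᴴ M(k) = h(k)·1` with `h > 0`, then
`‖L⁻⁴ Σ_k χ_k(x) conj χ_k(y) (M(k)ᴴ)_{αβ} / h(k)‖ ≤ 1 + L⁻⁴ Σ_k 1/h(k)`
(`|χ_k| = 1`, `|(M(k)ᴴ)_{αβ}| ≤ √h(k) ≤ h(k) + 1`). -/
theorem norm_fourier_entry_le (h : TorusSite 4 L → ℝ) (M : TorusSite 4 L → Matrix (Fin 4) (Fin 4) ℂ)
    (hM : ∀ k, (M k)ᴴ * M k = ((h k : ℝ) : ℂ) • (1 : Matrix (Fin 4) (Fin 4) ℂ))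
    (hpos : ∀ k, 0 < h k) (x y : TorusSite 4 L) (α β : Fin 4) :
    ‖((L : ℂ) ^ 4)⁻¹ * ∑ k, torusChar k x * conj (torusChar k y) * (M k)ᴴ α β / ((h k : ℝ) : ℂ)‖ ≤
      1 + ((L : ℝ) ^ 4)⁻¹ * ∑ k, (h k)⁻¹ := by
  have hL : (0 : ℝ) < (L : ℝ) ^ 4 := pow_pos (Nat.cast_pos.2 (Nat.pos_of_ne_zero (NeZero.ne L))) 4
  have hterm : ∀ k, ‖torusChar k x * conj (torusChar k y) * (M k)ᴴ α β / ((h k : ℝ) : ℂ)‖ ≤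
      1 + (h k)⁻¹ := by
    intro k
    have hk := hpos k
    have ha : ‖(M k)ᴴ α β‖ ≤ h k + 1 := by
      have hsq := norm_sq_conjTranspose_apply_le (M k) (h k) (hM k) α β
      nlinarith [sq_nonneg (‖(M k)ᴴ α β‖ - 1), norm_nonneg ((M k)ᴴ α β)]
    rw [norm_div, norm_mul, norm_mul, norm_torusChar, Complex.norm_conj, norm_torusChar, one_mul,
      one_mul, Complex.norm_of_nonneg hk.le, div_le_iff₀ hk, add_mul, one_mul, inv_mul_cancel₀ hk.ne']
    exact ha
  calc ‖((L : ℂ) ^ 4)⁻¹ * ∑ k, torusChar k x * conj (torusChar k y) * (M k)ᴴ α β / ((h k : ℝ) : ℂ)‖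
      = ((L : ℝ) ^ 4)⁻¹ *
          ‖∑ k, torusChar k x * conj (torusChar k y) * (M k)ᴴ α β / ((h k : ℝ) : ℂ)‖ := by
        rw [norm_mul, norm_inv, norm_pow, Complex.norm_natCast]
    _ ≤ ((L : ℝ) ^ 4)⁻¹ * ∑ k, (1 + (h k)⁻¹) := by
        gcongr
        exact (norm_sum_le _ _).trans (Finset.sum_le_sum fun k _ => hterm k)
    _ = 1 + ((L : ℝ) ^ 4)⁻¹ * ∑ k, (h k)⁻¹ := by
        rw [Finset.sum_add_distrib, Finset.sum_const, nsmul_eq_mul, mul_one, card_torusSite_four,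
          mul_add, inv_mul_cancel₀ hL.ne']

/-! ### Positivity of the symbol and the lattice sum on `m ∈ [-1/2, 1]` -/

/-- For `m ≥ -1/2`: the squared antiperiodic symbol `h(k) = (m + Σ_μ(1 − cos φ_μ))² + Σ_μ sin² φ_μ`,
`φ_μ = 2πk_μ/L + π/L`, is positive on the grid and `L⁻⁴ Σ_k 1/h(k) ≤ 16` (`stub_apLatticeSum` for
`|m| ≤ 1/2`; for `m > 1/2`, `h ≥ m² > 1/4` pointwise). -/
theorem symbol_pos_and_sum_le (L : ℕ) [NeZero L] (m : ℝ) (hm : -(1 / 2 : ℝ) ≤ m) :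
    (∀ k : TorusSite 4 L, 0 <
        (m + ∑ μ, (1 - Real.cos (2 * Real.pi * ((k μ).val : ℝ) / L + Real.pi / L))) ^ 2 +
          ∑ μ, Real.sin (2 * Real.pi * ((k μ).val : ℝ) / L + Real.pi / L) ^ 2) ∧
      ((L : ℝ) ^ 4)⁻¹ * ∑ k : TorusSite 4 L,
          ((m + ∑ μ, (1 - Real.cos (2 * Real.pi * ((k μ).val : ℝ) / L + Real.pi / L))) ^ 2 +
            ∑ μ, Real.sin (2 * Real.pi * ((k μ).val : ℝ) / L + Real.pi / L) ^ 2)⁻¹ ≤ 16 := by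
  by_cases hm2 : m ≤ 1 / 2
  · have hh := stub_apLatticeSum L m (abs_le.2 ⟨hm, hm2⟩)
    dsimp only at hh
    exact hh
  · have hm2 : 1 / 2 < m := lt_of_not_ge hm2
    have hL : (0 : ℝ) < (L : ℝ) ^ 4 := pow_pos (Nat.cast_pos.2 (Nat.pos_of_ne_zero (NeZero.ne L))) 4
    have hpt : ∀ k : TorusSite 4 L, 1 / 4 <
        (m + ∑ μ, (1 - Real.cos (2 * Real.pi * ((k μ).val : ℝ) / L + Real.pi / L))) ^ 2 +
          ∑ μ, Real.sin (2 * Real.pi * ((k μ).val : ℝ) / L + Real.pi / L) ^ 2 := by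
      intro k
      have hW : 0 ≤ ∑ μ, (1 - Real.cos (2 * Real.pi * ((k μ).val : ℝ) / L + Real.pi / L)) :=
        Finset.sum_nonneg fun μ _ => sub_nonneg.2 (Real.cos_le_one _)
      have hS : 0 ≤ ∑ μ, Real.sin (2 * Real.pi * ((k μ).val : ℝ) / L + Real.pi / L) ^ 2 :=
        Finset.sum_nonneg fun μ _ => sq_nonneg _
      nlinarith [mul_nonneg hW (show (0 : ℝ) ≤ 2 * m +
        ∑ μ, (1 - Real.cos (2 * Real.pi * ((k μ).val : ℝ) / L + Real.pi / L)) by linarith)]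
    refine ⟨fun k => lt_trans (by norm_num) (hpt k), ?_⟩
    calc ((L : ℝ) ^ 4)⁻¹ * ∑ k : TorusSite 4 L,
          ((m + ∑ μ, (1 - Real.cos (2 * Real.pi * ((k μ).val : ℝ) / L + Real.pi / L))) ^ 2 +
            ∑ μ, Real.sin (2 * Real.pi * ((k μ).val : ℝ) / L + Real.pi / L) ^ 2)⁻¹
        ≤ ((L : ℝ) ^ 4)⁻¹ * ∑ _k : TorusSite 4 L, (4 : ℝ) := by
          gcongr with k
          have hk := hpt k
          rw [one_div] at hk
          exact (inv_lt_of_inv_lt₀ (by norm_num) hk).le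
      _ = 4 := by
          rw [Finset.sum_const, nsmul_eq_mul, card_torusSite_four, ← mul_assoc,
            inv_mul_cancel₀ hL.ne', one_mul]
      _ ≤ 16 := by norm_num

/-! ### The propagator of the constant phase field -/

/-- **Entries of the free propagator of the constant phase field `ω = e^{iπ/L}·1`** (mass
`m ≥ -1/2`, `r = 1`): `‖D_ω⁻¹(p, q)‖ ≤ 17` for all `p, q`, uniformly in `L ≥ 1` and `m`
(Fourier representation `stub_freeTwistedFourier`, entry bound `norm_fourier_entry_le`, lattice sum
`symbol_pos_and_sum_le`). -/
theorem norm_inv_phase_apply_le (L : ℕ) [NeZero L] (m : ℝ) (hm : -(1 / 2 : ℝ) ≤ m)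
    {ω : Matrix.unitaryGroup (Fin 3) ℂ}
    (hω : (ω : Matrix (Fin 3) (Fin 3) ℂ) =
      Complex.exp (↑(Real.pi / L) * I) • (1 : Matrix (Fin 3) (Fin 3) ℂ))
    (p q : TorusSite 4 L × Fin 3 × Fin 4) :
    ‖(wilsonDirac (unitaryFundamentalRep (Fin 3) ℂ) (fun _ : Edge 4 L => ω) m 1)⁻¹ p q‖ ≤ 17 := by
  obtain ⟨hpos, hsum⟩ := symbol_pos_and_sum_le L m hm
  have hF := stub_freeTwistedFourier L (Real.pi / L) m ω hω
  dsimp only at hF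
  obtain ⟨-, -, hinv⟩ := hF hpos
  rw [hinv p q]
  split_ifs
  · refine (norm_fourier_entry_le (L := L)
      (fun k => (m + ∑ μ, (1 - Real.cos (2 * Real.pi * ((k μ).val : ℝ) / L + Real.pi / L))) ^ 2 +
        ∑ μ, Real.sin (2 * Real.pi * ((k μ).val : ℝ) / L + Real.pi / L) ^ 2)
      (fun k =>
        (((m + ∑ μ, (1 - Real.cos (2 * Real.pi * ((k μ).val : ℝ) / L + Real.pi / L))) : ℝ) : ℂ) •
            (1 : Matrix (Fin 4) (Fin 4) ℂ) +
          I • ∑ μ, ((Real.sin (2 * Real.pi * ((k μ).val : ℝ) / L + Real.pi / L) : ℝ) : ℂ) •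
            euclideanGamma μ)
      (fun k => clifford_conjTranspose_mul_self _ _) hpos p.1 q.1 p.2.2 q.2.2).trans ?_
    linarith
  · rw [norm_zero]; norm_num

end FreePropagatorBound

open FreePropagatorBound

/-- **All-entries bound of the free all-antiperiodic Wilson propagator** (stub
`free_ap_propagator_entry_bound`; Montvay–Münster §4.2.4): there is an absolute constant `C`
(`C = 153`) such that for every volume `L ≥ 1`, every bare mass `m ∈ [-1/2, 1]` and every pair of
fermion indices `p, q`, the free `r = 1` Wilson–Dirac operator of the trivial `U(3)` field with the
antiperiodic seam (sign `-1` on the links `e` with `e.1 e.2 = -1`, all four directions) satisfies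
`‖D⁻¹(p, q)‖ ≤ C`.  [cite: MontvayMunster1994, §4.2.4] -/
theorem free_ap_propagator_entry_bound :
    ∃ C : ℝ, ∀ (L : ℕ) [NeZero L] (m : ℝ), -(1 / 2 : ℝ) ≤ m → m ≤ 1 →
      ∀ p q : TorusSite 4 L × Fin 3 × Fin 4,
        ‖(wilsonDirac (unitaryFundamentalRep (Fin 3) ℂ)
            (fun e : Edge 4 L => if e.1 e.2 = -1 then (-1 : Matrix.unitaryGroup (Fin 3) ℂ) else 1) m 1)⁻¹
          p q‖ ≤ C := by
  refine ⟨9 * 17, fun L _ m hm _ p q => ?_⟩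
  set ω : Matrix.unitaryGroup (Fin 3) ℂ := ⟨_, phase_mem_unitaryGroup L⟩ with hωdef
  have hω : (ω : Matrix (Fin 3) (Fin 3) ℂ) =
      Complex.exp (↑(Real.pi / L) * I) • (1 : Matrix (Fin 3) (Fin 3) ℂ) := rfl
  rw [seam_eq_gaugeTransform_phase hω, wilsonDirac_gaugeTransform, inv_gaugeRotation_conj]
  exact norm_gaugeRotation_conj_le _ _ (norm_inv_phase_apply_le L m hm hω) p q

/-- **Ideator 2's `FreeDiagonalPropagatorBound`** (stub `free_diagonal_propagator_bound`): the
coincident-site block of the free all-antiperiodic Wilson propagator is bounded by an absolute constant,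
`‖D⁻¹((x,a,i),(x,b,j))‖ ≤ C` for all `L ≥ 2`, `m ∈ [0, 1]`, `x`, colours `a, b` and spins `i, j`
(immediate corollary of `free_ap_propagator_entry_bound`). [cite: MontvayMunster1994, §4.2.4] -/
theorem free_diagonal_propagator_bound :
    ∃ C : ℝ, ∀ (L : ℕ) [NeZero L], 2 ≤ L → ∀ m : ℝ, 0 ≤ m → m ≤ 1 →
      ∀ (x : TorusSite 4 L) (a b : Fin 3) (i j : Fin 4),
        ‖(wilsonDirac (unitaryFundamentalRep (Fin 3) ℂ)
            (fun e : Edge 4 L => if e.1 e.2 = -1 then (-1 : Matrix.unitaryGroup (Fin 3) ℂ) else 1) m 1)⁻¹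
          (x, a, i) (x, b, j)‖ ≤ C := by
  obtain ⟨C, hC⟩ := free_ap_propagator_entry_bound
  exact ⟨C, fun L _ _hL m hm0 hm1 x a b i j => hC L m (by linarith) hm1 _ _⟩

end Summit.QuantumFields.QCD.Cruxes.StableActionBridge.Sketch

end
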